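import Literature.Analysis.FluidPDE.Tao2016AveragedNS.RetunedTransition
import HarnessLib

/-!
# The seed–rotor scale knob: Theorem 5.3 for the two-scale family `rotorCircuit K M ε ρ`

T. Tao, *Finite time blowup for an averaged three-dimensional Navier–Stokes equation*, J. Amer.
Math. Soc. **29** (2016) 601–674 = arXiv:1402.0290, §5.5, Theorem 5.3 and its proof (pp. 28–30 of
the arXiv version). [`Tao2016AveragedNS`]

HONEST FRAMING (cell pub-fluidc): part of a low prior, high value-of-information experiment on
Tao's machine paradigm; NOT a claim that NS blows up.

## The question and the answer

In Tao's delay gate (5.5) and in the tree's retuned family `delayCircuitWith K M ε`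
(`GateRetuning.lean`, `RetunedTransition.lean`) ONE small parameter `ε` plays four roles: the clock
pump `ε : a → b`, the amplifier rate `ε⁻¹M : b ⇒ c`, the seed pump `ε²e^{-M} : a → c` and the rotor
`ε⁻² : c ∘ (a,d)`. This file separates the last two from the first two:

  `rotorCircuit K M ε ρ`:  clock `ε`, amplifier `ε⁻¹M`, seed `ρ²e^{-M}`, rotor `ρ⁻²`, drain `K`,

so that `rotorCircuit K M ε ε = delayCircuitWith K M ε` (`rotorCircuit_self`, by `rfl`). The whole
printed bootstrap proof of Theorem 5.3 (as ported to the family in `RetunedTransition.lean`, whose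
trajectory-free toolkit is reused BY NAME) is re-run with the two scales kept apart. RESULT
(`transition_explicit`, in `∃ C K₀ ρ₁`-form `rotorScaleTransition`): for
`K ≥ K₀ = 2·20⁴²·42! + 16`, `3000 log K ≤ M ≤ K¹⁰`, every POLYNOMIAL clock `0 < ε ≤ K⁻¹⁰⁰` and every
seed–rotor scale `0 < ρ` with

  `ρ⁴ ≤ ε² e^{-18M} / (64 M)`   (i.e. `ρ² ≤ ε·e^{-9M}/(8√M)`; Tao/tree: the diagonal `ρ = ε`),

every trajectory from `delayInit` makes the delayed abrupt transition with EXACTLY the tree's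
windows: `|t_c - √2| ≤ 24 log K / M`, quiet at level `200K⁻¹⁰` on all of `[0, t_c]`, fired at level
`200K⁻¹⁰` from `t_c + 880 log K / M + 1/√K` on. Read as a dictionary entry (DICTIONARY.md §47):
* the exponential scale separation Theorem 5.3 needs is between the CLOCK/AMPLIFIER pair and the
  SEED/ROTOR pair (`ρ² ≲ ε e^{-9M}`), not a smallness of the clock itself: the clock condition is
  the power law `ε ≤ K⁻¹⁰⁰`;
* the critical time does not see `ρ` at all: seed × rotor = `e^{-M}` is `ρ`-free, the trigger level
  `K⁻¹⁰ρ²` and the firing level `K¹⁰⁰ρ²` scale with the seed, and `ρ` CANCELS from the hitting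
  condition (`tc_window`);
* together with the trivial time-rescaling symmetry of quadratic circuits, the certified region of
  Theorem-5.3 behaviour becomes a set with NON-EMPTY INTERIOR in the 5-dimensional coupling space
  (clock, seed, amplifier, rotor, drain) of `GateBudget.fiveGateCircuit` — in logarithmic
  coordinates the map `(log λ, log ε, log ρ, M, log K) ↦ log (λ·(ε, ρ²e^{-M}, ε⁻¹M, ρ⁻², K))` is
  affine with constant Jacobian determinant `-4(1 + 1/M) ≠ 0` — whereas the one-scale family
  (`ρ = ε`) only certifies a hypersurface. (The time-rescaling `λ` is bookkeeping and is not
  formalised here.)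

## What is proved (sorry-free)
* `rotorCircuit`, `rotorCircuit_self`, `rotorCircuit_eq_gates`, `isCancelling_rotorCircuit`,
  `rotorCircuit_energy(_init)` — the family, its gates, energy conservation.
* the bootstrap of §5.5 for the family, lemma by lemma as in `RetunedTransition.lean` with the
  roles separated: (ob-2) `bc_small` (`ρ² ≤ ε`), (code) `c_crude` (`c ≤ 2ρ²e^{(5t-1)M}`), (dora)
  `de_small`, (able2) `a_near_one` (seed term `O(ρ⁴K⁻¹⁰)`), (bogo-2) `b_linear` (`Mρ⁴ ≤ ε²`),
  `c_upper_sharp`/`c_lower_sharp`/`tc_window` (`ρ` cancels), `b_lower_after`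
  (`4Mε⁻¹ρ⁴e^{18M} ≤ ε/16` — THE place where the exponential condition is spent), `c_growth`,
  (c-large) `c_large` (`c ≥ K¹⁰⁰ρ²`), (cgrow-2) `c_deriv_bounds`, the equipartition corrector
  `V = adρ²/c` (`hasDerivAt_V`, `V_remainder_le`), (atc) `e_tenth`, `hasDerivAt_Es`,
  `Es_dissipation`, (toke) `Es_decay`, (beable) `ad_small_late`, `late_sum_sq`, `beable_of_sum_sq`,
  (able) `able_window`; thresholds `clock_facts`, `rho_facts`.
* `transition_explicit`, `internalTimescales`, `rotorScaleTransition` — Theorem 5.3 along the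
  seed–rotor scale; `transitionWith_of_rotorKnob` — consistency: the
  diagonal `ρ = ε` re-derives `transitionWith_explicit` of `RetunedTransition.lean`.

## Architecture
Modes `(a,b,c,d,ã) = (X 0, X 1, X 2, X 3, X 4)`. Substitution table w.r.t. `RetunedTransition.lean`:
seed `ε²e^{-M} ↦ ρ²e^{-M}`, rotor `ε⁻² ↦ ρ⁻²`, trigger level `K⁻¹⁰ε² ↦ K⁻¹⁰ρ²`, firing level
`K¹⁰⁰ε² ↦ K¹⁰⁰ρ²`, corrector `ε²/c ↦ ρ²/c`, comparison constants `2ε²e^{…} ↦ 2ρ²e^{…}`; the clock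
roles (`εab`, `εa²`, `ε⁻¹M`, `|b|,|c| ≤ 5ε`, `ε² ≤ 1/(6K²⁰)`, `ε ≤ K⁻¹⁰⁰`) are untouched. New
hypotheses: `0 < ρ`, `ρ² ≤ ε` (from (ob-2) on), `Mρ⁴ ≤ ε²` (from (bogo-2) on),
`ρ⁴ ≤ ε²e^{-18M}/(64M)` (after `t_c`; it implies the other two once `M ≥ 1`, `rho_facts`).
Reused by name: `Thm53.{antitoneOn_intFactor, monotoneOn_intFactor, antitoneOn_sub_of_deriv_le,
monotoneOn_sub_of_le_deriv, exists_hitTime, abs_sub_le_of_abs_deriv_le, sqrt_two_gt, invSqrt_facts,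
Es_alg, decay_alg, numeric_N4, init_a … init_e}` (`DelayCircuitHolds.lean`) and
`Thm53With.{log_facts, abs_sub_sqrt_two_le, family_params, window_fits, eps_facts}`
(`RetunedTransition.lean`).

## References
* T. Tao, JAMS 29 (2016) 601–674, arXiv:1402.0290, §5.5 Theorem 5.3 and proof. [`Tao2016AveragedNS`]
-/

noncomputable section

namespace Summit.NavierStokesRegularity.FluidComputer.RotorKnob

open Set Real Filter
open _root_.Topology
open Literature.Analysis.FluidPDE.Tao2016AveragedNS
open Literature.Analysis.FluidPDE.Tao2016AveragedNS.Thm53 (antitoneOn_intFactor monotoneOn_intFactor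
  antitoneOn_sub_of_deriv_le monotoneOn_sub_of_le_deriv exists_hitTime abs_sub_le_of_abs_deriv_le
  sqrt_two_gt sqrt_two_lt invSqrt_facts Es_alg decay_alg numeric_N4 init_a init_b init_c init_d
  init_e)

/-! ## The two-scale family -/

/-- **The two-scale delay circuit**: (5.5) with the clock/amplifier scale `ε` and the seed/rotor
scale `ρ` separated: `∂ₜa = -ρ⁻²cd - εab - ρ²e^{-M}ac`, `∂ₜb = εa² - ε⁻¹Mc²`,
`∂ₜc = ρ²e^{-M}a² + ε⁻¹Mbc`, `∂ₜd = ρ⁻²ca - Kdã`, `∂ₜã = Kd²`. Framing: low prior, high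
value-of-information experiment on Tao's machine paradigm; NOT a claim that NS blows up.
[cite: Tao2016AveragedNS, §5.5 (5.5)] -/
def rotorCircuit (K M ε ρ : ℝ) (X : Fin 5 → ℝ) : Fin 5 → ℝ :=
  ![-((ρ ^ 2)⁻¹ * X 2 * X 3) - ε * X 0 * X 1 - ρ ^ 2 * Real.exp (-M) * X 0 * X 2,
    ε * X 0 ^ 2 - ε⁻¹ * M * X 2 ^ 2,
    ρ ^ 2 * Real.exp (-M) * X 0 ^ 2 + ε⁻¹ * M * X 1 * X 2,
    (ρ ^ 2)⁻¹ * X 2 * X 0 - K * X 3 * X 4,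
    K * X 3 ^ 2]

/-- The diagonal `ρ = ε` is the retuned family (and `M = K¹⁰`, `ρ = ε` is Tao's (5.5)).
[cite: Tao2016AveragedNS, §5.5 (5.5)] -/
theorem rotorCircuit_self (K M ε : ℝ) : rotorCircuit K M ε ε = delayCircuitWith K M ε := rfl

/-- The two-scale circuit is the superposition of the same five gates with couplings
(clock `ε`, seed `ρ²e^{-M}`, amplifier `ε⁻¹M`, rotor `ρ⁻²`, drain `K`).
[cite: Tao2016AveragedNS, §5.5] -/
theorem rotorCircuit_eq_gates (K M ε ρ : ℝ) :
    rotorCircuit K M ε ρ = pumpOn ε 0 1 + pumpOn (ρ ^ 2 * Real.exp (-M)) 0 2 +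
      amplifierOn (ε⁻¹ * M) 1 2 + rotorOn ((ρ ^ 2)⁻¹) 0 3 2 + pumpOn K 3 4 := by
  funext X; ext l
  fin_cases l <;> simp [rotorCircuit, pumpOn, amplifierOn, rotorOn] <;> ring

/-- Every member of the two-scale family cancels. [cite: Tao2016AveragedNS, §5.5 (energy-con)] -/
theorem isCancelling_rotorCircuit (K M ε ρ : ℝ) : IsCancelling (rotorCircuit K M ε ρ) := by
  rw [rotorCircuit_eq_gates]
  exact ((((isCancelling_pumpOn _ _ _).add (isCancelling_pumpOn _ _ _)).add
    (isCancelling_amplifierOn _ _ _)).add (isCancelling_rotorOn _ _ _ _)).add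
    (isCancelling_pumpOn _ _ _)

/-- Energy conservation along any trajectory of the two-scale circuit.
[cite: Tao2016AveragedNS, §5.5 (energy-con)] -/
theorem rotorCircuit_energy {K M ε ρ : ℝ} {X : ℝ → Fin 5 → ℝ}
    (hX : ∀ t, HasDerivAt X (rotorCircuit K M ε ρ (X t)) t) (t t₀ : ℝ) :
    energy (X t) = energy (X t₀) :=
  energy_eq_of_isCancelling (isCancelling_rotorCircuit K M ε ρ) hX t t₀

/-- From the datum (5.6) the energy is `1` for every member of the family.
[cite: Tao2016AveragedNS, §5.5 (energy-con)] -/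
theorem rotorCircuit_energy_init {K M ε ρ : ℝ} {X : ℝ → Fin 5 → ℝ}
    (hX : ∀ t, HasDerivAt X (rotorCircuit K M ε ρ (X t)) t) (h0 : X 0 = delayInit) (t : ℝ) :
    energy (X t) = 1 := by
  rw [rotorCircuit_energy hX t 0, h0]
  simp [energy, delayInit, Fin.sum_univ_five]
/-! ## Local energy identities of the family (as for (5.5)) -/

/-- `∂ₜ(b² + c²) = 2εa²b + 2ρ²e^{-M}a²c` along `rotorCircuit K M ε ρ` — the amplifier cancels.
[cite: Tao2016AveragedNS, §5.5 proof (ob-2)] -/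
theorem rotorCircuit_bc_energy {K M ε ρ : ℝ} {X : ℝ → Fin 5 → ℝ} {t : ℝ}
    (hX : HasDerivAt X (rotorCircuit K M ε ρ (X t)) t) :
    HasDerivAt (fun s => X s 1 ^ 2 + X s 2 ^ 2)
      (2 * ε * X t 0 ^ 2 * X t 1 + 2 * ρ ^ 2 * Real.exp (-M) * X t 0 ^ 2 * X t 2) t := by
  refine (((hasDerivAt_pi.1 hX 1).fun_pow 2).fun_add
    ((hasDerivAt_pi.1 hX 2).fun_pow 2)).congr_deriv ?_
  simp only [show (2 : ℕ) - 1 = 1 from rfl, pow_one, Nat.cast_ofNat, rotorCircuit, Fin.isValue,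
    Matrix.cons_val_one, Matrix.cons_val_two, Matrix.cons_val_zero, Matrix.head_cons,
    Matrix.tail_cons]
  ring

/-- `∂ₜ(d² + ã²) = 2ρ⁻²c·a·d` along `rotorCircuit K M ε ρ` — the drain cancels.
[cite: Tao2016AveragedNS, §5.5 proof (dora)] -/
theorem rotorCircuit_out_energy {K M ε ρ : ℝ} {X : ℝ → Fin 5 → ℝ} {t : ℝ}
    (hX : HasDerivAt X (rotorCircuit K M ε ρ (X t)) t) :
    HasDerivAt (fun s => X s 3 ^ 2 + X s 4 ^ 2)
      (2 * (ρ ^ 2)⁻¹ * X t 2 * X t 0 * X t 3) t := by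
  refine (((hasDerivAt_pi.1 hX 3).fun_pow 2).fun_add
    ((hasDerivAt_pi.1 hX 4).fun_pow 2)).congr_deriv ?_
  simp only [show (2 : ℕ) - 1 = 1 from rfl, pow_one, Nat.cast_ofNat, rotorCircuit, Fin.isValue,
    Matrix.cons_val]
  ring

/-- The output `ã` is non-decreasing along every trajectory of the family (`∂ₜã = Kd² ≥ 0`).
[cite: Tao2016AveragedNS, §5.5 (ta-eq)] -/
theorem rotorCircuit_output_monotone {K M ε ρ : ℝ} (hK : 0 ≤ K) {X : ℝ → Fin 5 → ℝ}
    (hX : ∀ t, HasDerivAt X (rotorCircuit K M ε ρ (X t)) t) : Monotone fun t => X t 4 := by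
  have hd : ∀ t, HasDerivAt (fun s => X s 4) (K * X t 3 ^ 2) t := fun t => by
    simpa [rotorCircuit] using hasDerivAt_pi.1 (hX t) 4
  refine monotone_of_deriv_nonneg (fun t => (hd t).differentiableAt) fun t => ?_
  rw [(hd t).deriv]
  positivity
variable {K M ε ρ : ℝ} {X : ℝ → Fin 5 → ℝ}

/-! ## The trajectory: components, energy, signs -/



/-- Each mode of a trajectory is continuous. [folklore] -/
theorem continuous_traj (hX : ∀ t, HasDerivAt X (rotorCircuit K M ε ρ (X t)) t) (i : Fin 5) :
    Continuous fun s => X s i :=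
  (continuous_apply i).comp (continuous_iff_continuousAt.2 fun t => (hX t).continuousAt)

/-- (a-eq): `∂ₜa = -ρ⁻²cd - εab - ρ²e^{-M}ac`. [cite: Tao2016AveragedNS, §5.5 (5.5)] -/
theorem hasDerivAt_a (hX : ∀ t, HasDerivAt X (rotorCircuit K M ε ρ (X t)) t) (t : ℝ) :
    HasDerivAt (fun s => X s 0)
      (-((ρ ^ 2)⁻¹ * X t 2 * X t 3) - ε * X t 0 * X t 1
        - ρ ^ 2 * exp (-M) * X t 0 * X t 2) t :=
  (hasDerivAt_pi.1 (hX t) 0).congr_deriv (by simp [rotorCircuit])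

/-- (b-eq): `∂ₜb = εa² - ε⁻¹Mc²`. [cite: Tao2016AveragedNS, §5.5 (5.5)] -/
theorem hasDerivAt_b (hX : ∀ t, HasDerivAt X (rotorCircuit K M ε ρ (X t)) t) (t : ℝ) :
    HasDerivAt (fun s => X s 1) (ε * X t 0 ^ 2 - ε⁻¹ * M * X t 2 ^ 2) t :=
  (hasDerivAt_pi.1 (hX t) 1).congr_deriv (by simp [rotorCircuit])

/-- (c-eq): `∂ₜc = ρ²e^{-M}a² + ε⁻¹Mbc`. [cite: Tao2016AveragedNS, §5.5 (5.5)] -/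
theorem hasDerivAt_c (hX : ∀ t, HasDerivAt X (rotorCircuit K M ε ρ (X t)) t) (t : ℝ) :
    HasDerivAt (fun s => X s 2)
      (ρ ^ 2 * exp (-M) * X t 0 ^ 2 + ε⁻¹ * M * X t 1 * X t 2) t :=
  (hasDerivAt_pi.1 (hX t) 2).congr_deriv (by simp [rotorCircuit])

/-- (d-eq): `∂ₜd = ρ⁻²ca - Kdã`. [cite: Tao2016AveragedNS, §5.5 (5.5)] -/
theorem hasDerivAt_d (hX : ∀ t, HasDerivAt X (rotorCircuit K M ε ρ (X t)) t) (t : ℝ) :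
    HasDerivAt (fun s => X s 3) ((ρ ^ 2)⁻¹ * X t 2 * X t 0 - K * X t 3 * X t 4) t :=
  (hasDerivAt_pi.1 (hX t) 3).congr_deriv (by simp [rotorCircuit])

/-- (ta-eq): `∂ₜã = Kd²`. [cite: Tao2016AveragedNS, §5.5 (5.5)] -/
theorem hasDerivAt_e (hX : ∀ t, HasDerivAt X (rotorCircuit K M ε ρ (X t)) t) (t : ℝ) :
    HasDerivAt (fun s => X s 4) (K * X t 3 ^ 2) t :=
  (hasDerivAt_pi.1 (hX t) 4).congr_deriv (by simp [rotorCircuit])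

/-- (energy-con) in components. [cite: Tao2016AveragedNS, §5.5 (energy-con)] -/
theorem traj_sum_sq_eq_one (hX : ∀ t, HasDerivAt X (rotorCircuit K M ε ρ (X t)) t)
    (h0 : X 0 = delayInit) (t : ℝ) :
    X t 0 ^ 2 + X t 1 ^ 2 + X t 2 ^ 2 + X t 3 ^ 2 + X t 4 ^ 2 = 1 := by
  have h := rotorCircuit_energy_init hX h0 t
  simpa [energy, Fin.sum_univ_five] using h

/-- (est): every mode is `O(1)`. [cite: Tao2016AveragedNS, §5.5 (est)] -/
theorem traj_sq_le_one (hX : ∀ t, HasDerivAt X (rotorCircuit K M ε ρ (X t)) t)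
    (h0 : X 0 = delayInit) (t : ℝ) (i : Fin 5) : X t i ^ 2 ≤ 1 := by
  have h := rotorCircuit_energy_init hX h0 t
  rw [energy] at h
  calc X t i ^ 2 ≤ ∑ j, X t j ^ 2 :=
        Finset.single_le_sum (f := fun j => X t j ^ 2) (fun j _ => sq_nonneg (X t j))
          (Finset.mem_univ i)
    _ = 1 := h

/-- (est): `|Xᵢ| ≤ 1`. [cite: Tao2016AveragedNS, §5.5 (est)] -/
theorem traj_abs_le_one (hX : ∀ t, HasDerivAt X (rotorCircuit K M ε ρ (X t)) t)
    (h0 : X 0 = delayInit) (t : ℝ) (i : Fin 5) : |X t i| ≤ 1 :=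
  sq_le_one_iff_abs_le_one _ |>.1 (traj_sq_le_one hX h0 t i)

/-- `ã ≥ 0` for `t ≥ 0` (it is non-decreasing from `0`). [cite: Tao2016AveragedNS, §5.5 proof] -/
theorem e_nonneg (hX : ∀ t, HasDerivAt X (rotorCircuit K M ε ρ (X t)) t) (h0 : X 0 = delayInit)
    (hK : 0 ≤ K) {t : ℝ} (ht : 0 ≤ t) : 0 ≤ X t 4 := by
  have := rotorCircuit_output_monotone hK hX ht
  simpa [init_e h0] using this

/-! ## (ob-2): `b, c = O(ε)` on `[0,2]` -/

/-- (ob-2), quantitatively: `|b|, |c| ≤ 5ε` on `[0,2]`, from the local energy identity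
`∂ₜ(b²+c²) = 2εa²b + 2μa²c` applied to `√(b²+c²+ε²)`. [cite: Tao2016AveragedNS, §5.5 (ob-2)] -/
theorem bc_small (hX : ∀ t, HasDerivAt X (rotorCircuit K M ε ρ (X t)) t) (h0 : X 0 = delayInit)
    (hε : 0 < ε) (hρ : 0 < ρ) (hρε : ρ ^ 2 ≤ ε) (hM0 : 0 ≤ M) {t : ℝ} (ht : t ∈ Icc 0 2) :
    |X t 1| ≤ 5 * ε ∧ |X t 2| ≤ 5 * ε := by
  set f : ℝ → ℝ := fun s => X s 1 ^ 2 + X s 2 ^ 2 with hf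
  set h : ℝ → ℝ := fun s => sqrt (f s + ε ^ 2) with hh
  have hfpos : ∀ s, 0 < f s + ε ^ 2 := fun s => by positivity
  have hb_le : ∀ s, |X s 1| ≤ h s := fun s =>
    abs_le_sqrt (by simp only [hf]; nlinarith [sq_nonneg (X s 2)])
  have hc_le : ∀ s, |X s 2| ≤ h s := fun s =>
    abs_le_sqrt (by simp only [hf]; nlinarith [sq_nonneg (X s 1)])
  have hder : ∀ s, HasDerivAt h
      ((2 * ε * X s 0 ^ 2 * X s 1 + 2 * ρ ^ 2 * exp (-M) * X s 0 ^ 2 * X s 2)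
        / (2 * sqrt (f s + ε ^ 2))) s := fun s =>
    ((rotorCircuit_bc_energy (hX s)).add_const (ε ^ 2)).sqrt (hfpos s).ne'
  have hbound : ∀ s, (2 * ε * X s 0 ^ 2 * X s 1 + 2 * ρ ^ 2 * exp (-M) * X s 0 ^ 2 * X s 2)
        / (2 * sqrt (f s + ε ^ 2)) ≤ 2 * ε := by
    intro s
    have hhpos : 0 < sqrt (f s + ε ^ 2) := sqrt_pos.2 (hfpos s)
    rw [div_le_iff₀ (by positivity)]
    have ha : X s 0 ^ 2 ≤ 1 := traj_sq_le_one hX h0 s 0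
    have ha0 : 0 ≤ X s 0 ^ 2 := sq_nonneg _
    have hek : exp (-M) ≤ 1 := by rw [exp_le_one_iff, neg_nonpos]; exact hM0
    have hbs : |X s 1| ≤ h s := hb_le s
    have hcs : |X s 2| ≤ h s := hc_le s
    have hb1 : X s 1 ≤ h s := (le_abs_self _).trans hbs
    have hc1 : X s 2 ≤ h s := (le_abs_self _).trans hcs
    have hc2 : -h s ≤ X s 2 := by have := neg_abs_le (X s 2); linarith
    have hh0 : 0 ≤ h s := (abs_nonneg _).trans hbs
    -- `a² b ≤ h`, `ρ² e^{-k} a² c ≤ ε h` (as `ρ² ≤ ε`, `|c| ≤ h`)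
    have h1 : X s 0 ^ 2 * X s 1 ≤ h s := by nlinarith
    have h21 : ρ ^ 2 * exp (-M) ≤ ε := by
      calc ρ ^ 2 * exp (-M) ≤ ρ ^ 2 * 1 :=
            mul_le_mul_of_nonneg_left hek (sq_nonneg _)
        _ = ρ ^ 2 := mul_one _
        _ ≤ ε := hρε
    have hεe : 0 ≤ ρ ^ 2 * exp (-M) := by positivity
    have h22 : |X s 0 ^ 2 * X s 2| ≤ h s := by
      rw [abs_mul, abs_of_nonneg ha0]; nlinarith [abs_nonneg (X s 2)]
    have h23 : ρ ^ 2 * exp (-M) * (X s 0 ^ 2 * X s 2) ≤ ε * h s := by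
      calc ρ ^ 2 * exp (-M) * (X s 0 ^ 2 * X s 2)
          ≤ ρ ^ 2 * exp (-M) * |X s 0 ^ 2 * X s 2| :=
            mul_le_mul_of_nonneg_left (le_abs_self _) hεe
        _ ≤ ε * h s := mul_le_mul h21 h22 (abs_nonneg _) hε.le
    have : h s = sqrt (f s + ε ^ 2) := rfl
    rw [← this]
    nlinarith
  -- `h - 2εt` is antitone on `[0,2]`
  have hanti := antitoneOn_sub_of_deriv_le (convex_Icc 0 2) (fun s _ => hder s)
    (fun s _ => ((hasDerivAt_id s).const_mul (2 * ε))) (fun s _ => by simpa using hbound s)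
  have h0mem : (0 : ℝ) ∈ Icc (0 : ℝ) 2 := ⟨le_rfl, by norm_num⟩
  have hmono := hanti h0mem ht ht.1
  have hh0 : h 0 = ε := by
    simp only [hh, hf, init_b h0, init_c h0]
    simpa using sqrt_sq hε.le
  simp only [hh0, id, mul_zero, sub_zero] at hmono
  have hht : h t ≤ 5 * ε := by
    have := ht.2
    nlinarith
  exact ⟨(hb_le t).trans hht, (hc_le t).trans hht⟩

/-! ## `c ≥ 0` and the crude Grönwall bound (code) -/

/-- `c(t) ≥ 0` for `t ≥ 0` ("from the initial condition `c(0)=0` and a comparison argument"),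
via the integrating factor `exp(-∫₀ᵗ ε⁻¹M b)`. [cite: Tao2016AveragedNS, §5.5 proof] -/
theorem c_nonneg (hX : ∀ t, HasDerivAt X (rotorCircuit K M ε ρ (X t)) t) (h0 : X 0 = delayInit)
    {t : ℝ} (ht : 0 ≤ t) : 0 ≤ X t 2 := by
  set G : ℝ → ℝ := fun s => ∫ r in (0 : ℝ)..s, ε⁻¹ * M * X r 1 with hG
  have hGd : ∀ s, HasDerivAt G (ε⁻¹ * M * X s 1) s := fun s =>
    ((continuous_const.mul (continuous_traj hX 1)).integral_hasStrictDerivAt 0 s).hasDerivAt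
  have hmono := monotoneOn_intFactor (s := univ) (φ := fun _ => 0) (Φ := fun _ => 0) convex_univ
    (fun s _ => hasDerivAt_c hX s) (fun s _ => hGd s) (fun s _ => hasDerivAt_const s (0 : ℝ))
    (fun s _ => by
      have : (ρ ^ 2 * exp (-M) * X s 0 ^ 2 + ε⁻¹ * M * X s 1 * X s 2
          - ε⁻¹ * M * X s 1 * X s 2) * exp (-G s)
          = ρ ^ 2 * exp (-M) * X s 0 ^ 2 * exp (-G s) := by ring
      rw [this]; positivity)
  have h := hmono (mem_univ 0) (mem_univ t) ht
  simp only [init_c h0, zero_mul, sub_zero] at h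
  exact (mul_nonneg_iff_of_pos_right (exp_pos (-G t))).1 h

end Summit.NavierStokesRegularity.FluidComputer.RotorKnob
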